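import Summits.AtomisticToContinuum.BoseEinsteinCondensation.Theorems.BECGroundStateSOSPeriodicIRBoundDifficultyFloor
import Summits.AtomisticToContinuum.BoseEinsteinCondensation.Theorems.PeriodicIRBound.Negative.NormalForms
import Summits.AtomisticToContinuum.BoseEinsteinCondensation.Theses.BECParentAnchor
import HarnessLib

/-!
# Crux `PeriodicIRBound` (stmt-AtomisticToContinuum-3972) — redirect strategist r1, typed companion of
# `STRATEGY-CENSUS.md` v4 (second opinion after census v3 / seat s2)

Nothing in this file is a route item and nothing restates or weakens the crux on the ledger.  It TYPES,
over the landed per-potential normal form of the crux (`Negative.IRBoundFor`, `IRBoundWith`, `NearMin`,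
`InWindow`, `IRIneq`; `Negative.periodicIRBound_iff`), the objects quoted in census v4:

* §1  the SUMMIT-STRENGTH CERTIFICATE the redirect instruction asks for: the crux implies torus
      Bose–Einstein condensation in the thermodynamic box for EVERY admissible potential — a re-export, by
      name, of the landed `DifficultyFloor.periodicBECFor_of_periodicIRBound` (Theorems/…DifficultyFloor.lean),
      so that the tribunal has one declaration to point at;
* §2  the best typed split found under `## Decomposition` (D13, "deep window / annulus"): for a window
      cut `κ₁`, `DeepFor v κ₁` (the crux's inequality on `‖k‖ ≤ κ₁√ρ L_N` only) and `AnnulusFor v κ₁`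
      (the inequality on `κ₁√ρ L_N < ‖k‖ ≤ κ√ρ L_N` for every `κ > κ₁`), with the glue
      `irBoundFor_of_split` / `periodicIRBound_of_windowSplit` PROVED (pure logic + `min`/`max`) and the two
      converses PROVED (`deepFor_of_irBoundFor`, `annulusFor_of_irBoundFor`), i.e. the split is an honest
      EQUIVALENCE `X ↔ Deep ∧ Annulus`; neither piece feeds the route's mode counting on its own (census D13:
      the kinetic Markov tail cannot close the annulus for `κ₁² < 2a/π`, and the deep sum is useless without
      the annulus), and neither piece has an engine — which is why it is NOT filed;
* §3  the weakening direction S⁻ recorded for the TENURE planner (a strategist never weakens a crux): the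
      `ρ`-free form `RhoFreeSmallFor` ("for every `B > 0`, below some density, `n_k ≤ B·L_N/‖k‖` on the
      window"), implied by the crux (`rhoFreeSmallFor_of_irBoundFor`, PROVED) and still sufficient for the
      counting glue with `B = B(a)` (census S⁻2: the crux over-asks by the factor `C√ρ → 0`).

All proofs are compositions / monotonicity; no `sorry`.

References: [LSSY2005] Lieb–Seiringer–Solovej–Yngvason, *The Mathematics of the Bose Gas and its
Condensation* (2005), Ch. 5 p. 35 ("The problem remains open after more than 75 years"), Ch. 11
pp. 117–124 (infrared bounds ⇒ BEC; "no one has so far found a way … without using reflection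
positivity and infrared bounds"); [KLS1988PRL] Kennedy–Lieb–Shastry, Phys. Rev. Lett. 61 (1988) 2582.
-/

noncomputable section

open MeasureTheory Filter
open scoped ENNReal NNReal BigOperators Classical

namespace Summit.AtomisticToContinuum.BoseEinsteinCondensation.Cruxes.PeriodicIRBound.StrategistR1

open Literature.MathematicalPhysics.QuantumManyBody.BoseGas
open Summit.AtomisticToContinuum.BoseEinsteinCondensation.Theses.BECGroundStateSOS (PeriodicIRBound)
open Summit.AtomisticToContinuum.BoseEinsteinCondensation.Theorems.PeriodicIRBound.Negative
  (NearMin InWindow IRIneq IRBoundFor IRBoundWith periodicIRBound_iff irBoundFor_iff)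
open Summit.AtomisticToContinuum.BoseEinsteinCondensation.Cruxes.GDTransfer.DysonDressedWitness (PeriodicBECFor)
open Summit.AtomisticToContinuum.BoseEinsteinCondensation.Cruxes.PeriodicIRBound.DifficultyFloor
  (periodicBECFor_of_periodicIRBound)

/-! ## §1  Summit-strength certificate (instruction item (3)) -/

/-- **The crux is at least the torus form of the conjunct.** `PeriodicIRBound` implies, for EVERY
repulsive finite-range pair potential, Bose–Einstein condensation of the periodic near-minimisers in the
thermodynamic box `L_N = (N/ρ)^{1/3}` at every small density (`PeriodicBECFor v` = the body of the torus
conjunct `PeriodicBEC` at `v`): landed as `DifficultyFloor.periodicBECFor_of_periodicIRBound`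
(= `Negative.periodicIRBound_iff` + the route's own mode counting `periodicBEC_of_irBoundFor`, p99222).
Torus TL-BEC is the open problem of [LSSY2005, Ch. 5 p. 35]; the infrared bound is the hypothesis whose
absence IS that problem [LSSY2005, Ch. 11 pp. 117–124]. [cite: LSSY2005, Ch. 5 p. 35; Ch. 11 §11.3] -/
theorem summit_strength (hX : PeriodicIRBound) :
    ∀ v : ℝ → ℝ≥0∞, IsRepulsiveFiniteRange v → PeriodicBECFor v :=
  periodicBECFor_of_periodicIRBound hX

/-- **The crux implies the shared torus-BEC item BY NAME**: stmt-AtomisticToContinuum-8997 `PeriodicBEC`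
(target/crux of ≥ 13 routes; verbatim `BECPeriodicReduction.PeriodicBEC` = stmt-0826, the torus form of the
conjunct; print-equivalent to the Dirichlet conjunct, Lean-linked to it by the open transfer crux
`BoundaryTransferWeak` = stmt-0827).  The landed certificate is definitionally a proof (axioms standard).
This is the theorem "that makes the crux summit-strength" asked for by the redirect instruction (3).
[cite: LSSY2005, Ch. 5 p. 35; Ch. 11 §11.3] -/
theorem periodicBEC_8997_of_periodicIRBound (hX : PeriodicIRBound) :
    Summit.AtomisticToContinuum.BoseEinsteinCondensation.Theses.BECParentAnchor.PeriodicBEC :=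
  fun v hv => periodicBECFor_of_periodicIRBound hX v hv

/-! ## §2  D13 — the deep-window / annulus split (typed, glue and converses proved; NOT filed) -/

/-- The DEEP piece at window cut `κ₁`: the crux's inequality for the modes `0 < ‖k‖ ≤ κ₁ √ρ L_N` only
(one window parameter, constants `ρ₀, C` existential). -/
def DeepFor (v : ℝ → ℝ≥0∞) (κ₁ : ℝ) : Prop :=
  ∃ ρ₀ : ℝ, 0 < ρ₀ ∧ ∃ C : ℝ, 0 < C ∧ IRBoundWith v κ₁ ρ₀ C

/-- The ANNULUS inequality with explicit constants: the crux's bound for the modes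
`κ₁ √ρ L_N < ‖k‖ ≤ κ √ρ L_N`. -/
def AnnulusWith (v : ℝ → ℝ≥0∞) (κ₁ κ ρ₀ C : ℝ) : Prop :=
  ∀ ρ : ℝ, 0 < ρ → ρ < ρ₀ → ∀ᶠ N : ℕ in atTop, ∃ δ : ℝ≥0∞, 0 < δ ∧
    ∀ Ψ : PeriodicTrialState N (sideLength ρ N), NearMin v ρ N δ Ψ →
      ∀ k : Fin 3 → ℤ, InWindow κ ρ N k →
        κ₁ * Real.sqrt ρ * sideLength ρ N < ‖(fun j => (k j : ℝ))‖ → IRIneq C ρ N Ψ.ψ k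

/-- The ANNULUS piece at window cut `κ₁`: for every larger window `κ > κ₁` the crux's inequality on the
annulus `κ₁ √ρ L_N < ‖k‖ ≤ κ √ρ L_N`. -/
def AnnulusFor (v : ℝ → ℝ≥0∞) (κ₁ : ℝ) : Prop :=
  ∀ κ : ℝ, κ₁ < κ → ∃ ρ₀ : ℝ, 0 < ρ₀ ∧ ∃ C : ℝ, 0 < C ∧ AnnulusWith v κ₁ κ ρ₀ C

/-- **Glue of D13, per potential (PROVED):** deep piece and annulus piece at the same cut `κ₁ > 0`
give the crux for `v` — windows `κ ≤ κ₁` by antitonicity, larger windows by splitting each mode on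
`‖k‖ ≤ κ₁√ρL_N` with `ρ₀ := min`, `C := max`, `δ := min`. [folklore] -/
theorem irBoundFor_of_split {v : ℝ → ℝ≥0∞} {κ₁ : ℝ} (hD : DeepFor v κ₁) (hA : AnnulusFor v κ₁) :
    IRBoundFor v := by
  intro κ _
  obtain ⟨ρ₀, hρ₀, C, hC, hDW⟩ := hD
  rcases le_or_gt κ κ₁ with hle | hlt
  · exact ⟨ρ₀, hρ₀, C, hC, hDW.mono hle le_rfl le_rfl⟩
  · obtain ⟨ρ₀', hρ₀', C', hC', hAW⟩ := hA κ hlt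
    refine ⟨min ρ₀ ρ₀', lt_min hρ₀ hρ₀', max C C', lt_max_of_lt_left hC, fun ρ hρ hρlt => ?_⟩
    filter_upwards [hDW ρ hρ (hρlt.trans_le (min_le_left _ _)),
      hAW ρ hρ (hρlt.trans_le (min_le_right _ _))] with N hN hN'
    obtain ⟨δ, hδ, hN⟩ := hN
    obtain ⟨δ', hδ', hN'⟩ := hN'
    refine ⟨min δ δ', lt_min hδ hδ', fun Ψ hΨ k hk => ?_⟩
    have hΨ₁ : NearMin v ρ N δ Ψ := le_trans hΨ (add_le_add le_rfl (min_le_left _ _))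
    have hΨ₂ : NearMin v ρ N δ' Ψ := le_trans hΨ (add_le_add le_rfl (min_le_right _ _))
    rcases le_or_gt ‖(fun j => (k j : ℝ))‖ (κ₁ * Real.sqrt ρ * sideLength ρ N) with h | h
    · exact (hN Ψ hΨ₁ k ⟨hk.1, h⟩).mono hρ (le_max_left _ _)
    · exact (hN' Ψ hΨ₂ k hk h).mono hρ (le_max_right _ _)

/-- **Glue of D13 for the crux by name (PROVED):** with any potential-dependent cut `κ₁ v`
(e.g. `κ₁ v = c·√(scatteringLength v)` with `c` so small that the kinetic Markov tail cannot close the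
annulus), deep pieces and annulus pieces for all admissible `v` give `PeriodicIRBound`. [folklore] -/
theorem periodicIRBound_of_windowSplit (κ₁ : (ℝ → ℝ≥0∞) → ℝ)
    (hD : ∀ v, IsRepulsiveFiniteRange v → DeepFor v (κ₁ v))
    (hA : ∀ v, IsRepulsiveFiniteRange v → AnnulusFor v (κ₁ v)) : PeriodicIRBound :=
  periodicIRBound_iff.2 fun v hv => irBoundFor_of_split (hD v hv) (hA v hv)

/-- Converse 1 (PROVED): the crux for `v` gives the deep piece at every cut `κ₁ > 0`. [folklore] -/
theorem deepFor_of_irBoundFor {v : ℝ → ℝ≥0∞} (h : IRBoundFor v) {κ₁ : ℝ} (hκ₁ : 0 < κ₁) :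
    DeepFor v κ₁ :=
  h κ₁ hκ₁

/-- Converse 2 (PROVED): the crux for `v` gives the annulus piece at every cut `κ₁ ≥ 0`. [folklore] -/
theorem annulusFor_of_irBoundFor {v : ℝ → ℝ≥0∞} (h : IRBoundFor v) {κ₁ : ℝ} (hκ₁ : 0 ≤ κ₁) :
    AnnulusFor v κ₁ := by
  intro κ hκ
  obtain ⟨ρ₀, hρ₀, C, hC, hW⟩ := h κ (hκ₁.trans_lt hκ)
  refine ⟨ρ₀, hρ₀, C, hC, fun ρ hρ hρρ₀ => ?_⟩
  filter_upwards [hW ρ hρ hρρ₀] with N ⟨δ, hδ, hN⟩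
  exact ⟨δ, hδ, fun Ψ hΨ k hk _ => hN Ψ hΨ k hk⟩

/-- D13 is an honest EQUIVALENCE per potential: `IRBoundFor v ↔ DeepFor v κ₁ ∧ AnnulusFor v κ₁`
for every cut `κ₁ > 0`. [folklore] -/
theorem irBoundFor_iff_split {v : ℝ → ℝ≥0∞} {κ₁ : ℝ} (hκ₁ : 0 < κ₁) :
    IRBoundFor v ↔ DeepFor v κ₁ ∧ AnnulusFor v κ₁ :=
  ⟨fun h => ⟨deepFor_of_irBoundFor h hκ₁, annulusFor_of_irBoundFor h hκ₁.le⟩,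
    fun h => irBoundFor_of_split h.1 h.2⟩

/-! ## §3  S⁻ — the `ρ`-free weakening (route-level note for tenure; typed, implied by the crux) -/

/-- The `ρ`-FREE per-mode bound with explicit data: `n_k ≤ B · L_N / ‖k‖` on the window
(`IRIneq (B/√ρ) ρ N Ψ k` unfolds to `n_k ≤ (B/√ρ)·√ρ·L_N/‖k‖`). -/
def RhoFreeWith (v : ℝ → ℝ≥0∞) (κ ρ₀ B : ℝ) : Prop :=
  ∀ ρ : ℝ, 0 < ρ → ρ < ρ₀ → ∀ᶠ N : ℕ in atTop, ∃ δ : ℝ≥0∞, 0 < δ ∧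
    ∀ Ψ : PeriodicTrialState N (sideLength ρ N), NearMin v ρ N δ Ψ →
      ∀ k : Fin 3 → ℤ, InWindow κ ρ N k → IRIneq (B / Real.sqrt ρ) ρ N Ψ.ψ k

/-- **S⁻2, the weakest per-mode shape of the crux that still feeds mode counting:** for every window `κ`
and EVERY `B > 0` there is a density threshold below which `n_k ≤ B·L_N/‖k‖` on the window.  With
`B = B(a)` small against `1/a` (census S⁻2: `B ≤ π/(7168 a)` at `κ² = 32a/π`) the window sum is `≤ N/16` and
the counting glue runs; the crux instead pins the constant at the Bogoliubov SCALE `C√ρ` (`→ 0`).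
(Constants: with the sup-norm shell count `#{‖k‖_∞ = m} ≤ 26m²` of `IRModeCounting`, the window sum of
`B·L_N/‖k‖` is `≤ 14Bκ²N`, so `B ≤ 1/(224κ²) = π/(7168a)` at `κ² = 32a/π` gives `≤ N/16`.) -/
def RhoFreeSmallFor (v : ℝ → ℝ≥0∞) : Prop :=
  ∀ κ : ℝ, 0 < κ → ∀ B : ℝ, 0 < B → ∃ ρ₀ : ℝ, 0 < ρ₀ ∧ RhoFreeWith v κ ρ₀ B

/-- The crux for `v` implies its `ρ`-free weakening (PROVED): given `(ρ₀, C)` from the crux, below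
`min ρ₀ (B/C)²` one has `C ≤ B/√ρ`. [folklore] -/
theorem rhoFreeSmallFor_of_irBoundFor {v : ℝ → ℝ≥0∞} (h : IRBoundFor v) : RhoFreeSmallFor v := by
  intro κ hκ B hB
  obtain ⟨ρ₀, hρ₀, C, hC, hW⟩ := h κ hκ
  refine ⟨min ρ₀ ((B / C) ^ 2), lt_min hρ₀ (by positivity), fun ρ hρ hρlt => ?_⟩
  filter_upwards [hW ρ hρ (hρlt.trans_le (min_le_left _ _))] with N ⟨δ, hδ, hN⟩
  refine ⟨δ, hδ, fun Ψ hΨ k hk => (hN Ψ hΨ k hk).mono hρ ?_⟩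
  -- `C ≤ B / √ρ` because `ρ < (B/C)²`
  have hρlt' : ρ < (B / C) ^ 2 := hρlt.trans_le (min_le_right _ _)
  have hsqrt : Real.sqrt ρ < B / C := by
    calc Real.sqrt ρ < Real.sqrt ((B / C) ^ 2) := Real.sqrt_lt_sqrt hρ.le hρlt'
      _ = B / C := Real.sqrt_sq (by positivity)
  have hsρ : 0 < Real.sqrt ρ := Real.sqrt_pos.2 hρ
  rw [le_div_iff₀ hsρ]
  have := (lt_div_iff₀ hC).1 hsqrt
  nlinarith

/-- The crux implies the `ρ`-free weakening for every admissible potential (PROVED). [folklore] -/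
theorem rhoFreeSmall_of_periodicIRBound (hX : PeriodicIRBound) :
    ∀ v : ℝ → ℝ≥0∞, IsRepulsiveFiniteRange v → RhoFreeSmallFor v :=
  fun v hv => rhoFreeSmallFor_of_irBoundFor (periodicIRBound_iff.1 hX v hv)

end Summit.AtomisticToContinuum.BoseEinsteinCondensation.Cruxes.PeriodicIRBound.StrategistR1

end
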